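import Summits.CriticalPhenomena.PercolationContinuityZ3.Theorems.PercNearOneGluingNoHeavyLowerTailKnQuestion8CoefficientwiseCoreClassKernelMixBoundaryPrefixFlows
import Summits.CriticalPhenomena.PercolationContinuityZ3.Theorems.PercNearOneGluingNoHeavyLowerTailKnQuestion8CoefficientwiseCoreClassKernelMixBundleBoundaryTransfer
import HarnessLib

/-!
# Boundary inequality on bundles, V: THEOREM BI in the kernel (cluster form, all 0/1 levels)

Support file (`--supports stmt-CriticalPhenomena-4575`, closed), prover `prim-cplus-coupling` (gen 46).  No definitions, no notations, no named facts,
no sorries; standard axioms.  Memo `prim-cplus-coupling/A5-COUPLING-gen45.md` §3.9 (THEOREM BI = the S-statement for every cycle), now machine-checked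
by the kernel.

SETTING.  An explicit bundle `Θ(ℓ₁..ℓ_r)` (`…KernelMixBundleTraces`): threads `t < r`, `w t 0 = u, …, w t (L t) = b`, edges `e t j`, edge sets `A t`,
`E = ⋃ A t`; two distinguished threads `p ≠ q` and a third thread `t₀` (so `r ≥ 3`); `O = E ∖ (A p ∪ A q)`; `C ω = C_u(ω)` the red cluster, `C(E∖ω)`
the blue cluster.  LEVELS: arbitrary monotone `{0,1}`-valued `hᵃ, hᵇ, kᵃ, kᵇ : Set V → ℝ` (no thread support, no regime hypothesis) and an
arbitrary up-closed event `𝒱`.  With the memo's statuses (`bad₁ = hᵃX = kᵇY = 1, hᵇY = kᵃX = 0`, `bad₂ = hᵇY = kᵃX = 1, hᵃX = kᵇY = 0`,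
`P₁ = hᵃX = kᵃX = 1, hᵇY = kᵇY = 0` at DEMAND points `b ∈ Y ∖ X`; `L₁ = hᵃX = kᵇX = 1, hᵇY = kᵃY = 0`, `L₂ = kᵃX = hᵇX = 1, kᵇY = hᵃY = 0` at
SUPPLY points `b ∈ X ∖ Y`):
THEOREM `Coefficientwise.bundle_boundary_count` (THEOREM BI):
  `#bad₁(𝒱, O blue) + #bad₂(𝒱, O blue) ≤ #(L₁ ∪ L₂)(𝒱, O red) + #P₁(𝒱, O blue)`,
where 'O blue' ranges over the colourings `ξ ⊆ A p ∪ A q` (all other threads blue) and 'O red' over their lifts `ξ ∪ O` (all other threads red).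
For `r = 3` this is memo §3.9 verbatim (`t₀` = the thread `t`, sources/joins with `t` empty, targets with `t` full); for `r ≥ 4` it is the same
statement with all of the other threads frozen (`S(cycle)` for the cycle `A p ∪ A q`).  PROOF = `boundary_prefix_flows_count` (…KernelMixBoundaryPrefixFlows:
prefix-frozen Harris flows, the three-way assignment, self-paying all-mixed collisions) with the cluster-trace transfer and the chain lemma of
`…KernelMixBundleBoundaryTransfer`.  Since `L₁ ∪ L₂ ⊆ S = {h(X) = k(X) = 1}` whenever `hᵃ, kᵇ ≤ h`-type dominations hold, this is a piece of the
LP1/IET programme (memo gen 42–45) valid for ALL levels.  [cite: KozmaNitzan2024, Questions 8–9 (§5.5 p. 36) (context); Harris 1960]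
-/

namespace Summit.CriticalPhenomena.PercolationContinuityZ3.Theorems

open Finset Literature.Probability.Percolation

namespace Coefficientwise

variable {ι V : Type*}

open Classical in
/-- **THEOREM BI (boundary inequality on a bundle, all 0/1 levels).**  On an explicit bundle with distinguished threads `p ≠ q` and a further thread `t₀`,
for every up-closed event `𝒱` and all monotone `{0,1}`-valued levels `hᵃ, hᵇ, kᵃ, kᵇ`:
`#{ξ ⊆ A p ∪ A q : 𝒱, demand, bad₁} + #{ξ : 𝒱, demand, bad₂} ≤ #{ξ : lift ξ ∪ O ∈ 𝒱, supply, L₁ ∨ L₂} + #{ξ : 𝒱, demand, P₁}` (module docstring;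
memo gen 45 §3.9).  [cite: KozmaNitzan2024, Questions 8–9 (§5.5 p. 36) (context); Harris 1960] -/
theorem bundle_boundary_count (ends : ι → Sym2 V) (r : ℕ) (L : ℕ → ℕ) (hL : ∀ t, t < r → 1 ≤ L t)
    (w : ℕ → ℕ → V) (e : ℕ → ℕ → ι) (u b : V)
    (hw0 : ∀ t, t < r → w t 0 = u) (hwL : ∀ t, t < r → w t (L t) = b)
    (harc : ∀ t, t < r → ∀ j, 1 ≤ j → j ≤ L t → ends (e t j) = s(w t (j - 1), w t j))
    (hwinj : ∀ t, t < r → ∀ i j, i ≤ L t → j ≤ L t → w t i = w t j → i = j)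
    (hcross : ∀ t t', t < r → t' < r → t ≠ t' → ∀ i j, i ≤ L t → j ≤ L t' → w t i = w t' j → (i = 0 ∧ j = 0) ∨ (i = L t ∧ j = L t'))
    (A : ℕ → Finset ι) (hA : ∀ t, t < r → ∀ i, i ∈ A t ↔ ∃ j, 1 ≤ j ∧ j ≤ L t ∧ e t j = i)
    (hAdisj : ∀ t t', t < r → t' < r → t ≠ t' → Disjoint (A t) (A t'))
    (E : Finset ι) (hEA : ∀ i, i ∈ E ↔ ∃ t, t < r ∧ i ∈ A t)
    (p q : ℕ) (hp : p < r) (hq : q < r) (hpq : p ≠ q) (t₀ : ℕ) (ht₀ : t₀ < r) (ht₀p : t₀ ≠ p) (ht₀q : t₀ ≠ q)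
    (𝒱 : Finset ι → Prop) (hV : ∀ ⦃s t : Finset ι⦄, s ⊆ t → 𝒱 s → 𝒱 t)
    (ha hb ka kb : Set V → ℝ) (mha : Monotone ha) (mhb : Monotone hb) (mka : Monotone ka) (mkb : Monotone kb)
    (ha01 : ∀ S, ha S = 0 ∨ ha S = 1) (hb01 : ∀ S, hb S = 0 ∨ hb S = 1) (ka01 : ∀ S, ka S = 0 ∨ ka S = 1) (kb01 : ∀ S, kb S = 0 ∨ kb S = 1) :
    (((A p ∪ A q).powerset).filter (fun ξ => 𝒱 ξ ∧
        (b ∈ openCluster (ends '' (↑(E \ ξ) : Set ι)) u ∧ b ∉ openCluster (ends '' (↑ξ : Set ι)) u) ∧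
        (ha (openCluster (ends '' (↑ξ : Set ι)) u) = 1 ∧ kb (openCluster (ends '' (↑(E \ ξ) : Set ι)) u) = 1 ∧
          hb (openCluster (ends '' (↑(E \ ξ) : Set ι)) u) = 0 ∧ ka (openCluster (ends '' (↑ξ : Set ι)) u) = 0))).card
    + (((A p ∪ A q).powerset).filter (fun ξ => 𝒱 ξ ∧
        (b ∈ openCluster (ends '' (↑(E \ ξ) : Set ι)) u ∧ b ∉ openCluster (ends '' (↑ξ : Set ι)) u) ∧
        (hb (openCluster (ends '' (↑(E \ ξ) : Set ι)) u) = 1 ∧ ka (openCluster (ends '' (↑ξ : Set ι)) u) = 1 ∧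
          ha (openCluster (ends '' (↑ξ : Set ι)) u) = 0 ∧ kb (openCluster (ends '' (↑(E \ ξ) : Set ι)) u) = 0))).card
    ≤ (((A p ∪ A q).powerset).filter (fun ξ => 𝒱 (ξ ∪ E \ (A p ∪ A q)) ∧
        (b ∈ openCluster (ends '' (↑(ξ ∪ E \ (A p ∪ A q)) : Set ι)) u ∧
          b ∉ openCluster (ends '' (↑(E \ (ξ ∪ E \ (A p ∪ A q))) : Set ι)) u) ∧
        ((ha (openCluster (ends '' (↑(ξ ∪ E \ (A p ∪ A q)) : Set ι)) u) = 1 ∧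
            kb (openCluster (ends '' (↑(ξ ∪ E \ (A p ∪ A q)) : Set ι)) u) = 1 ∧
            hb (openCluster (ends '' (↑(E \ (ξ ∪ E \ (A p ∪ A q))) : Set ι)) u) = 0 ∧
            ka (openCluster (ends '' (↑(E \ (ξ ∪ E \ (A p ∪ A q))) : Set ι)) u) = 0) ∨
          (ka (openCluster (ends '' (↑(ξ ∪ E \ (A p ∪ A q)) : Set ι)) u) = 1 ∧
            hb (openCluster (ends '' (↑(ξ ∪ E \ (A p ∪ A q)) : Set ι)) u) = 1 ∧
            kb (openCluster (ends '' (↑(E \ (ξ ∪ E \ (A p ∪ A q))) : Set ι)) u) = 0 ∧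
            ha (openCluster (ends '' (↑(E \ (ξ ∪ E \ (A p ∪ A q))) : Set ι)) u) = 0)))).card
      + (((A p ∪ A q).powerset).filter (fun ξ => 𝒱 ξ ∧
        (b ∈ openCluster (ends '' (↑(E \ ξ) : Set ι)) u ∧ b ∉ openCluster (ends '' (↑ξ : Set ι)) u) ∧
        (ha (openCluster (ends '' (↑ξ : Set ι)) u) = 1 ∧ ka (openCluster (ends '' (↑ξ : Set ι)) u) = 1 ∧
          hb (openCluster (ends '' (↑(E \ ξ) : Set ι)) u) = 0 ∧ kb (openCluster (ends '' (↑(E \ ξ) : Set ι)) u) = 0))).card := by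
  set C : Finset ι → Set V := fun ω => openCluster (ends '' (↑ω : Set ι)) u with hC
  -- ## bundle bookkeeping
  have hr : 0 < r := lt_of_le_of_lt (Nat.zero_le p) hp
  have hAE : ∀ t, t < r → A t ⊆ E := fun t ht i hi => (hEA i).mpr ⟨t, ht, hi⟩
  have heA : ∀ t, t < r → ∀ j, 1 ≤ j → j ≤ L t → e t j ∈ A t := fun t ht j hj1 hjL => (hA t ht _).mpr ⟨j, hj1, hjL, rfl⟩
  have hE : ∀ i, i ∈ E → ∃ t, t < r ∧ ∃ j, 1 ≤ j ∧ j ≤ L t ∧ e t j = i := by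
    intro i hi
    obtain ⟨t, ht, hit⟩ := (hEA i).mp hi
    exact ⟨t, ht, (hA t ht i).mp hit⟩
  have full_iff : ∀ ω : Finset ι, ω ⊆ E → (b ∈ C ω ↔ ∃ t, t < r ∧ A t ⊆ ω) := fun ω hω =>
    bundle_b_mem_cluster_iff_threads ends r L hL w e u b hr hw0 hwL harc hwinj hcross A hA E hEA ω hω
  have hPQE : A p ∪ A q ⊆ E := Finset.union_subset (hAE p hp) (hAE q hq)
  have other_notPQ : ∀ t, t < r → t ≠ p → t ≠ q → ∀ x ∈ A t, x ∉ A p ∪ A q := by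
    intro t ht htp htq x hx hm
    rcases Finset.mem_union.mp hm with h1 | h1
    · exact Finset.disjoint_left.mp (hAdisj t p ht hp htp) hx h1
    · exact Finset.disjoint_left.mp (hAdisj t q ht hq htq) hx h1
  -- edges of one thread are pairwise distinct
  have einj : ∀ t, t < r → ∀ i j, 1 ≤ i → i ≤ L t → 1 ≤ j → j ≤ L t → e t i = e t j → i = j := by
    intro t ht i j hi1 hiL hj1 hjL hij
    have h := harc t ht i hi1 hiL
    rw [hij, harc t ht j hj1 hjL] at h
    rcases Sym2.eq_iff.mp h with ⟨h1, _⟩ | ⟨h1, h2⟩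
    · have := hwinj t ht (j - 1) (i - 1) (by omega) (by omega) h1; omega
    · have e1 := hwinj t ht (j - 1) i (by omega) hiL h1
      have e2 := hwinj t ht j (i - 1) hjL (by omega) h2
      omega
  -- no full thread in a colouring of the two threads
  have nofull : ∀ σ : Finset ι, σ ⊆ A p ∪ A q → ¬ A p ⊆ σ → ¬ A q ⊆ σ → ∀ t, t < r → ∃ j, 1 ≤ j ∧ j ≤ L t ∧ e t j ∉ σ := by
    intro σ hσ hnP hnQ t ht
    by_cases htp : t = p
    · subst htp
      obtain ⟨x, hx, hxσ⟩ := Finset.not_subset.mp hnP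
      obtain ⟨j, hj1, hjL, rfl⟩ := (hA t ht x).mp hx
      exact ⟨j, hj1, hjL, hxσ⟩
    by_cases htq : t = q
    · subst htq
      obtain ⟨x, hx, hxσ⟩ := Finset.not_subset.mp hnQ
      obtain ⟨j, hj1, hjL, rfl⟩ := (hA t ht x).mp hx
      exact ⟨j, hj1, hjL, hxσ⟩
    exact ⟨1, le_refl 1, hL t ht, fun hm => other_notPQ t ht htp htq _ (heA t ht 1 (le_refl 1) (hL t ht)) (hσ hm)⟩
  -- the demand region on colourings of the two threads
  have dem : ∀ ξ : Finset ι, ξ ⊆ A p ∪ A q → ((b ∈ C (E \ ξ) ∧ b ∉ C ξ) ↔ (¬ A p ⊆ ξ ∧ ¬ A q ⊆ ξ)) := by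
    intro ξ hξ
    rw [full_iff (E \ ξ) Finset.sdiff_subset, full_iff ξ (hξ.trans hPQE)]
    constructor
    · rintro ⟨-, hno⟩
      exact ⟨fun h => hno ⟨p, hp, h⟩, fun h => hno ⟨q, hq, h⟩⟩
    · rintro ⟨hnP, hnQ⟩
      refine ⟨⟨t₀, ht₀, fun x hx => Finset.mem_sdiff.mpr ⟨hAE t₀ ht₀ hx, fun hm => other_notPQ t₀ ht₀ ht₀p ht₀q x hx (hξ hm)⟩⟩, ?_⟩
      rintro ⟨t, ht, hsub⟩
      obtain ⟨j, hj1, hjL, hn⟩ := nofull ξ hξ hnP hnQ t ht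
      exact hn (hsub (heA t ht j hj1 hjL))
  -- 0/1 bookkeeping
  have one_of_ge : ∀ (f : Set V → ℝ), (∀ S, f S = 0 ∨ f S = 1) → ∀ S S' : Set V, S ⊆ S' → Monotone f → f S = 1 → f S' = 1 := by
    intro f f01 S S' hSS' mf h1
    rcases f01 S' with h0 | h0
    · have := mf hSS'; rw [h1, h0] at this; linarith
    · exact h0
  have zero_of_le : ∀ (f : Set V → ℝ), (∀ S, f S = 0 ∨ f S = 1) → ∀ S S' : Set V, S ⊆ S' → Monotone f → f S' = 0 → f S = 0 := by
    intro f f01 S S' hSS' mf h0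
    rcases f01 S with h1 | h1
    · exact h1
    · have := mf hSS'; rw [h1, h0] at this; linarith
  have Cmono : ∀ s t : Finset ι, s ⊆ t → C s ⊆ C t := fun s t hst => openCluster_image_mono ends hst u
  have Ccompl : ∀ s t : Finset ι, s ⊆ t → C (E \ t) ⊆ C (E \ s) := fun s t hst => Cmono _ _ (Finset.sdiff_subset_sdiff (le_refl E) hst)
  -- the chain lemma for sources of the two types
  have chain : ∀ (z o : ℕ), z < r → o < r → z ≠ o → (z = p ∨ z = q) → (o = p ∨ o = q) →
      ∀ σ₁ σ₂ : Finset ι, σ₁ ⊆ A p ∪ A q → σ₂ ⊆ A p ∪ A q →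
      (𝒱 σ₁ ∧ (¬ A p ⊆ σ₁ ∧ ¬ A q ⊆ σ₁) ∧ (ha (C σ₁) = 1 ∧ hb (C (E \ σ₁)) = 0) ∧ (kb (C (E \ σ₁)) = 1 ∧ ka (C σ₁) = 0)) →
      (𝒱 σ₂ ∧ (¬ A p ⊆ σ₂ ∧ ¬ A q ⊆ σ₂) ∧ (ka (C σ₂) = 1 ∧ kb (C (E \ σ₂)) = 0) ∧ (hb (C (E \ σ₂)) = 1 ∧ ha (C σ₂) = 0)) →
      e z 1 ∉ σ₁ → e z 1 ∉ σ₂ → False := by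
    intro z o hz ho hzo hzpq hopq σ₁ σ₂ hσ₁ hσ₂ hs₁ hs₂ hz₁ hz₂
    have hstart : ∀ σ : Finset ι, σ ⊆ A p ∪ A q → e z 1 ∉ σ → ∀ t, t < r → t ≠ o → e t 1 ∉ σ := by
      intro σ hσ hzσ t ht hto hm
      by_cases htz : t = z
      · subst htz; exact hzσ hm
      have htp : t ≠ p := by
        intro htp
        rcases hzpq with hz' | hz'
        · exact htz (htp.trans hz'.symm)
        · rcases hopq with ho' | ho'
          · exact hto (htp.trans ho'.symm)
          · exact hzo (hz'.trans ho'.symm)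
      have htq : t ≠ q := by
        intro htq
        rcases hzpq with hz' | hz'
        · rcases hopq with ho' | ho'
          · exact hzo (hz'.trans ho'.symm)
          · exact hto (htq.trans ho'.symm)
        · exact htz (htq.trans hz'.symm)
      exact other_notPQ t ht htp htq _ (heA t ht 1 (le_refl 1) (hL t ht)) (hσ hm)
    have hcmp := bundle_boundary_chain ends r L w e u hw0 harc hwinj hcross E hE o σ₁ σ₂ (hσ₁.trans hPQE) (hσ₂.trans hPQE)
      (nofull σ₁ hσ₁ hs₁.2.1.1 hs₁.2.1.2) (nofull σ₂ hσ₂ hs₂.2.1.1 hs₂.2.1.2) (hstart σ₁ hσ₁ hz₁) (hstart σ₂ hσ₂ hz₂)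
    rcases hcmp with hsub | hsub
    · have h1 := one_of_ge ha ha01 _ _ hsub mha hs₁.2.2.1.1
      have h0 := hs₂.2.2.2.2
      rw [h1] at h0; exact one_ne_zero h0
    · have h1 := one_of_ge ka ka01 _ _ hsub mka hs₂.2.2.1.1
      have h0 := hs₁.2.2.2.2
      rw [h1] at h0; exact one_ne_zero h0
  -- the transfer for both types (level-free part)
  have transfer := fun (a c : ℕ) (haL : a < L p) (hcL : c < L q) (ξ ρ : Finset ι) (hξ : ξ ⊆ A p ∪ A q) (hρ : ρ ⊆ A p ∪ A q)
      hPa hPa1 hPfree hQc hQc1 hQfree (hNP : ¬ A p ⊆ ρ) (hNQ : ¬ A q ⊆ ρ) =>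
    bundle_boundary_transfer ends r L hL w e u b hw0 hwL harc hwinj hcross A hA hAdisj E hEA p q hp hq hpq t₀ ht₀ ht₀p ht₀q a c haL hcL ξ ρ hξ hρ
      hPa hPa1 hPfree hQc hQc1 hQfree hNP hNQ
  -- ## the abstract theorem
  refine boundary_prefix_flows_count (A p) (A q) (hAdisj p q hp hq hpq) (L p) (L q) (hL p hp) (hL q hq) (e p) (e q)
    (heA p hp) (einj p hp) (fun x hx => (hA p hp x).mp hx) (heA q hq) (einj q hq) (fun x hx => (hA q hq x).mp hx)
    𝒱 (fun ξ => ha (C ξ) = 1 ∧ hb (C (E \ ξ)) = 0) (fun ξ => ka (C ξ) = 1 ∧ kb (C (E \ ξ)) = 0)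
    (fun ξ => hb (C (E \ ξ)) = 1 ∧ ha (C ξ) = 0) (fun ξ => kb (C (E \ ξ)) = 1 ∧ ka (C ξ) = 0)
    (fun ξ => 𝒱 (ξ ∪ E \ (A p ∪ A q)) ∧ (b ∈ C (ξ ∪ E \ (A p ∪ A q)) ∧ b ∉ C (E \ (ξ ∪ E \ (A p ∪ A q)))) ∧
      (ha (C (ξ ∪ E \ (A p ∪ A q))) = 1 ∧ kb (C (ξ ∪ E \ (A p ∪ A q))) = 1 ∧
        hb (C (E \ (ξ ∪ E \ (A p ∪ A q)))) = 0 ∧ ka (C (E \ (ξ ∪ E \ (A p ∪ A q)))) = 0))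
    (fun ξ => 𝒱 (ξ ∪ E \ (A p ∪ A q)) ∧ (b ∈ C (ξ ∪ E \ (A p ∪ A q)) ∧ b ∉ C (E \ (ξ ∪ E \ (A p ∪ A q)))) ∧
      (ka (C (ξ ∪ E \ (A p ∪ A q))) = 1 ∧ hb (C (ξ ∪ E \ (A p ∪ A q))) = 1 ∧
        kb (C (E \ (ξ ∪ E \ (A p ∪ A q)))) = 0 ∧ ha (C (E \ (ξ ∪ E \ (A p ∪ A q)))) = 0))
    (fun s t hst hs => hV hst hs) ?_ ?_ ?_ ?_ ?_ ?_ ?_ ?_ _ _ _ _ ?_ ?_ ?_ ?_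
  · -- hro increasing
    intro s t hst hs
    exact ⟨one_of_ge ha ha01 _ _ (Cmono s t hst) mha hs.1, zero_of_le hb hb01 _ _ (Ccompl s t hst) mhb hs.2⟩
  · -- kro increasing
    intro s t hst hs
    exact ⟨one_of_ge ka ka01 _ _ (Cmono s t hst) mka hs.1, zero_of_le kb kb01 _ _ (Ccompl s t hst) mkb hs.2⟩
  · -- hbo decreasing
    intro s t hst ht
    exact ⟨one_of_ge hb hb01 _ _ (Ccompl s t hst) mhb ht.1, zero_of_le ha ha01 _ _ (Cmono s t hst) mha ht.2⟩
  · -- kbo decreasing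
    intro s t hst ht
    exact ⟨one_of_ge kb kb01 _ _ (Ccompl s t hst) mkb ht.1, zero_of_le ka ka01 _ _ (Cmono s t hst) mka ht.2⟩
  · -- transfer, type 1
    intro a c haL hcL ξ ρ hξ hρ hPa hPa1 hPfree hQc hQc1 hQfree hv hh hk hNP hNQ
    obtain ⟨hbX, hbY, T2, T3⟩ := transfer a c haL hcL ξ ρ hξ hρ hPa hPa1 hPfree hQc hQc1 hQfree hNP hNQ
    exact ⟨hV Finset.subset_union_left hv, ⟨hbX, hbY⟩, one_of_ge ha ha01 _ _ (Cmono _ _ Finset.subset_union_left) mha hh.1,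
      one_of_ge kb kb01 _ _ T2 mkb hk.1, zero_of_le hb hb01 _ _ (Ccompl _ _ Finset.subset_union_left) mhb hh.2,
      zero_of_le ka ka01 _ _ T3 mka hk.2⟩
  · -- transfer, type 2
    intro a c haL hcL ξ ρ hξ hρ hPa hPa1 hPfree hQc hQc1 hQfree hv hk hh hNP hNQ
    obtain ⟨hbX, hbY, T2, T3⟩ := transfer a c haL hcL ξ ρ hξ hρ hPa hPa1 hPfree hQc hQc1 hQfree hNP hNQ
    exact ⟨hV Finset.subset_union_left hv, ⟨hbX, hbY⟩, one_of_ge ka ka01 _ _ (Cmono _ _ Finset.subset_union_left) mka hk.1,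
      one_of_ge hb hb01 _ _ T2 mhb hh.1, zero_of_le kb kb01 _ _ (Ccompl _ _ Finset.subset_union_left) mkb hk.2,
      zero_of_le ha ha01 _ _ T3 mha hh.2⟩
  · -- chain on thread p (the free thread is q)
    intro σ₁ σ₂ hσ₁ hσ₂ hs₁ hs₂ h₁ h₂
    exact chain p q hp hq hpq (Or.inl rfl) (Or.inr rfl) σ₁ σ₂ hσ₁ hσ₂ hs₁ hs₂ h₁ h₂
  · -- chain on thread q (the free thread is p)
    intro σ₁ σ₂ hσ₁ hσ₂ hs₁ hs₂ h₁ h₂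
    exact chain q p hq hp (Ne.symm hpq) (Or.inr rfl) (Or.inl rfl) σ₁ σ₂ hσ₁ hσ₂ hs₁ hs₂ h₁ h₂
  · -- sources of type 1
    intro ξ
    rw [Finset.mem_filter, Finset.mem_powerset]
    constructor
    · rintro ⟨hξ, hv, hd, h1, h2, h3, h4⟩
      exact ⟨hξ, hv, (dem ξ hξ).mp hd, ⟨h1, h3⟩, ⟨h2, h4⟩⟩
    · rintro ⟨hξ, hv, hn, ⟨h1, h3⟩, ⟨h2, h4⟩⟩
      exact ⟨hξ, hv, (dem ξ hξ).mpr hn, h1, h2, h3, h4⟩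
  · -- sources of type 2
    intro ξ
    rw [Finset.mem_filter, Finset.mem_powerset]
    constructor
    · rintro ⟨hξ, hv, hd, h1, h2, h3, h4⟩
      exact ⟨hξ, hv, (dem ξ hξ).mp hd, ⟨h2, h4⟩, ⟨h1, h3⟩⟩
    · rintro ⟨hξ, hv, hn, ⟨h2, h4⟩, ⟨h1, h3⟩⟩
      exact ⟨hξ, hv, (dem ξ hξ).mpr hn, h1, h2, h3, h4⟩
  · -- targets
    intro ξ
    rw [Finset.mem_filter, Finset.mem_powerset]
    constructor
    · rintro ⟨hξ, hv, hR, hL⟩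
      rcases hL with hL | hL
      · exact ⟨hξ, Or.inl ⟨hv, hR, hL⟩⟩
      · exact ⟨hξ, Or.inr ⟨hv, hR, hL⟩⟩
    · rintro ⟨hξ, hT⟩
      rcases hT with ⟨hv, hR, hL⟩ | ⟨hv, hR, hL⟩
      · exact ⟨hξ, hv, hR, Or.inl hL⟩
      · exact ⟨hξ, hv, hR, Or.inr hL⟩
  · -- joins
    intro ξ
    rw [Finset.mem_filter, Finset.mem_powerset]
    constructor
    · rintro ⟨hξ, hv, hd, h1, h2, h3, h4⟩
      exact ⟨hξ, hv, (dem ξ hξ).mp hd, ⟨h1, h3⟩, ⟨h2, h4⟩⟩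
    · rintro ⟨hξ, hv, hn, ⟨h1, h3⟩, ⟨h2, h4⟩⟩
      exact ⟨hξ, hv, (dem ξ hξ).mpr hn, h1, h2, h3, h4⟩

end Coefficientwise

end Summit.CriticalPhenomena.PercolationContinuityZ3.Theorems
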